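import Summits.QuantumFields.YangMills.Theorems.FluctuationComparisonRegPrIntLOrganTangentFibreMeanVersionMW
import HarnessLib

/-!
# THE m-STEP (MULTI-LEVEL-WINDOW) SECOND-MOMENT VERSION: KNIT-MW, FROM A HEIGHT, AND FROM THE FRAME'S CUT CLAUSE — R-VAR's `v` IN THE v18 (H∕MW) FRAME, DEFINITION-FREE

Cell `ym3-torus` (YM ladder rung R3 = continuum `SU(2)` Yang–Mills on the three-torus — a RUNG, NOT d = 4, NOT infinite volume, NOT a mass gap, NOT Clay).  Width seat
`ym-ust-20520-w4` (gen 22), LEAD-20520 w3 g25 WORD №3 (E-H) «order: MW second-moment version first (S), then the E2E (M)»; `--supports stmt-QuantumFields-20520 --as helper`,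
count-neutral, definition-free, default heartbeats; no registry, binder or `Lines/` edit (★★OWNER RULING №36).

WHAT.  The three theorems of the fibre-MEAN MW lane with the integrand `χ·(log r − log r′)·r′` SQUARED to `χ·(log r − log r′)²·r′` and `m` renamed `v`, NOTHING else — the
MW∕`descendTo` editions of ✓p787883 `…OrganTangentSecondMomentVersion` (LEAD w3 g23) and ✓p794297 `…SecondMomentVersionClosed` (this seat):
§1 ★`fibreSecondMomentVersion_descendTo_of_regularSmallFieldDisintegration_ac` = w5 g22's ✓(L17) KNIT-MW `…FibreMeanVersionKnitDescendTo.fibreMeanVersion_descendTo_of_regularSmallFieldDisintegration_ac`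
(proof verbatim; the one changed line is the continuity of the squared integrand); §2 ★`exists_height_fibreSecondMomentVersion_descendTo` = ✓(L17) §2 from a height over ✓(L16)
`exists_height_regularSmallFieldDisintegration_descendTo`; §3 ★★`exists_height_fibreSecondMomentVersionMW_of_towerCut'` = w5 g22's ✓(L20′)
`…FibreMeanVersionMW.exists_height_fibreMeanVersionMW_of_towerCut'` (clause ⑦ on `[j, K)`, `Measurable (ρ j)` only, ANY disintegration `σ` of `dU_K` along `descendTo j K`)
⟹ the `window_j`-continuous version `v` of the `χ_{j,K}`-localised fibre SECOND MOMENT of `log ρ_K − log ρ′`, from one height, every family and depth — the object VARᵘ-H∕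
LME3ᵘ-H quantify (R-VAR in the H∕MW frame).  Generated BY SCRIPT from the two tree files (substitution counts asserted).

HONEST FRAMING: a regularity frame (disintegration uniqueness, (A)-package along `descendTo`, window continuity); nothing of Bałaban's renormalisation-group analysis is asserted;
VARᵘ-H ∕ LME3ᵘ-H ∕ JENᵘ-H ∕ LINᵘ-H, O1ᵘ-H v2, the crux `FluctuationComparisonRegPrIntL` (stmt-QuantumFields-20520) and `YM3TorusSU2` are NOT proved; rung R3 = SU(2) YM₃ on T³ — NOT
d = 4, NOT infinite volume, NOT a mass gap, NOT Clay; the Yang–Mills mass gap is NOT proved.  Credit: w5 g22 ((L15)–(L20′) MW lane), LEAD w3 g22∕g23 (KNIT, SecondMomentVersion);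
this seat re-keyed.
[cite: Balaban1985Averaging, (10)-(13) p.19; Balaban1987RG1, (0.11) p.253 and (0.13) p.254; Balaban1985UV3, (7) p.257]
-/

set_option autoImplicit false

noncomputable section

namespace Summit.QuantumFields.YangMills.Theorems.OrganTangentSecondMomentVersionMW

open MeasureTheory ProbabilityTheory Filter Topology Set Function
open scoped ENNReal NNReal
open Literature.MathematicalPhysics.QuantumFieldTheory.Balaban1983to89
open T3ContinuumYM3Torus T3NestedUnitLaws T3UnitLawDensityEML T3UnitScaleTilt T3LevelShift T3TiltDescent
open Literature.MathematicalPhysics.QuantumFieldTheory.Balaban1983to89.T3OrbitAverage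
open Summit.QuantumFields.YangMills.Theorems.OrganTangentFibreMeanTools
open Summit.QuantumFields.YangMills.BalabanUVNodes.N09DomAltThresholdNull (isOpen_setOf_plaqSmall_SU)
open Summit.QuantumFields.YangMills.Theorems.OrganTangentFibreMeanToolsAnyCut (measurable_sfCutRamp)
open Summit.QuantumFields.YangMills.Theorems.FluctuationComparisonRegPrIntLOrganTangentAPackageDescendTo (exists_height_regularSmallFieldDisintegration_descendTo)
open Summit.QuantumFields.YangMills.Theorems.FluctuationComparisonRegPrIntLOrganTangentFibreMeanVersionKnitDescendTo
open Summit.QuantumFields.YangMills.Theorems.FluctuationComparisonRegPrIntLOrganTangentTowerCutIterate (towerCut_iterate measurable_iterWeight)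
open Summit.QuantumFields.YangMills.Theorems.FluctuationComparisonRegPrIntLOrganTangentMultiWindowWeight (exists_height_multiWindowWeight)

/-! ## §1 KNIT-MW with the integrand squared -/

/-- ★ **KNIT-MW FOR THE SECOND MOMENT**: ✓(L17) `fibreMeanVersion_descendTo_of_regularSmallFieldDisintegration_ac` with `χ·(log r − log r′)·r′ ↦ χ·(log r − log r′)²·r′`
(`m ↦ v`); proof verbatim. [cite: Balaban1985Averaging, (10)-(13) p.19; Balaban1987RG1, (0.13) p.254] -/
theorem fibreSecondMomentVersion_descendTo_of_regularSmallFieldDisintegration_ac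
    (F : T3Family) (γ b₀ p₀ : ℝ) (j K : ℕ) (hjK : j + 1 ≤ K) (hθ : 0 < θBal F.L γ b₀ p₀ K)
    (r r' : GaugeField (F.P K) 0 ↥(Matrix.specialUnitaryGroup (Fin 2) ℂ) → ℝ)
    (rj : GaugeField (F.P j) 0 ↥(Matrix.specialUnitaryGroup (Fin 2) ℂ) → ℝ)
    (hpos : ∀ U, PlaqSmall (θBal F.L γ b₀ p₀ K) U → 0 < r U ∧ 0 < r' U)
    (hr : ContinuousOn r {U | PlaqSmall (θBal F.L γ b₀ p₀ K) U})
    (hr' : ContinuousOn r' {U | PlaqSmall (θBal F.L γ b₀ p₀ K) U})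
    (hrj : Measurable rj) (hrjpos : ∀ V, PlaqSmall (θBal F.L γ b₀ p₀ j) V → 0 < rj V)
    (mY : Measure (GaugeField (F.P K) 0 ↥(Matrix.specialUnitaryGroup (Fin 2) ℂ)))
    (hmY : mY ≪ fieldMeasure (F.P K) 0 ↥(Matrix.specialUnitaryGroup (Fin 2) ℂ))
    (hcons : mY.map (descendTo F ℰp j K (Nat.le_of_succ_le hjK)) =
      (fieldMeasure (F.P j) 0 ↥(Matrix.specialUnitaryGroup (Fin 2) ℂ)).withDensity (fun V => ENNReal.ofReal (rj V)))
    (σ : Kernel (GaugeField (F.P j) 0 ↥(Matrix.specialUnitaryGroup (Fin 2) ℂ))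
      (GaugeField (F.P K) 0 ↥(Matrix.specialUnitaryGroup (Fin 2) ℂ)))
    (hσM : IsMarkovKernel σ)
    (hbind : (Measure.map (descendTo F ℰp j K (Nat.le_of_succ_le hjK)) (fieldMeasure (F.P K) 0 ↥(Matrix.specialUnitaryGroup (Fin 2) ℂ))).bind ⇑σ =
      fieldMeasure (F.P K) 0 ↥(Matrix.specialUnitaryGroup (Fin 2) ℂ))
    (hfib : ∀ᵐ V ∂(Measure.map (descendTo F ℰp j K (Nat.le_of_succ_le hjK)) (fieldMeasure (F.P K) 0 ↥(Matrix.specialUnitaryGroup (Fin 2) ℂ))),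
      ∀ᵐ U ∂(σ V), descendTo F ℰp j K (Nat.le_of_succ_le hjK) U = V)
    (χ : GaugeField (F.P K) 0 ↥(Matrix.specialUnitaryGroup (Fin 2) ℂ) → ℝ) (hχc : Continuous χ) (hχ0 : ∀ U, 0 ≤ χ U)
    (hχsupp : ∀ U, χ U ≠ 0 → (∀ (n : ℕ) (hjn : j + 1 ≤ n) (hnK : n ≤ K), PlaqSmall (24 / 25 * θBal F.L γ b₀ p₀ n) (descendTo F ℰp n K hnK U)))
    (hχpos : ∀ U, (∀ (n : ℕ) (hjn : j + 1 ≤ n) (hnK : n ≤ K), PlaqSmall (24 / 25 * θBal F.L γ b₀ p₀ n) (descendTo F ℰp n K hnK U)) → 0 < χ U)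
    (σ₀ : Kernel (GaugeField (F.P j) 0 ↥(Matrix.specialUnitaryGroup (Fin 2) ℂ))
      (GaugeField (F.P K) 0 ↥(Matrix.specialUnitaryGroup (Fin 2) ℂ)))
    (hσ₀M : IsMarkovKernel σ₀)
    (hbind₀ : (Measure.map (descendTo F ℰp j K (Nat.le_of_succ_le hjK)) (fieldMeasure (F.P K) 0 ↥(Matrix.specialUnitaryGroup (Fin 2) ℂ))).bind ⇑σ₀ =
      fieldMeasure (F.P K) 0 ↥(Matrix.specialUnitaryGroup (Fin 2) ℂ))
    (hfib₀ : ∀ᵐ V ∂(Measure.map (descendTo F ℰp j K (Nat.le_of_succ_le hjK)) (fieldMeasure (F.P K) 0 ↥(Matrix.specialUnitaryGroup (Fin 2) ℂ))),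
      ∀ᵐ U ∂(σ₀ V), descendTo F ℰp j K (Nat.le_of_succ_le hjK) U = V)
    (lam : GaugeField (F.P j) 0 ↥(Matrix.specialUnitaryGroup (Fin 2) ℂ) →
      Measure (GaugeField (F.P K) 0 ↥(Matrix.specialUnitaryGroup (Fin 2) ℂ)))
    (hlam : ∀ V, IsFiniteMeasure (lam V))
    (hA1 : ∀ f : GaugeField (F.P K) 0 ↥(Matrix.specialUnitaryGroup (Fin 2) ℂ) → ℝ, Continuous f →
      (∀ U, f U ≠ 0 → (∀ (n : ℕ) (hjn : j + 1 ≤ n) (hnK : n ≤ K), PlaqSmall (24 / 25 * θBal F.L γ b₀ p₀ n) (descendTo F ℰp n K hnK U))) →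
      ContinuousOn (fun V => ∫ U, f U ∂(lam V)) {V | PlaqSmall (θBal F.L γ b₀ p₀ j) V})
    (hA2 : ∀ V, PlaqSmall (θBal F.L γ b₀ p₀ j) V → 0 < lam V {U | (∀ (n : ℕ) (hjn : j + 1 ≤ n) (hnK : n ≤ K), PlaqSmall (24 / 25 * θBal F.L γ b₀ p₀ n) (descendTo F ℰp n K hnK U))})
    (hA3 : ∃ c : GaugeField (F.P j) 0 ↥(Matrix.specialUnitaryGroup (Fin 2) ℂ) → ℝ,
      ∀ f : GaugeField (F.P K) 0 ↥(Matrix.specialUnitaryGroup (Fin 2) ℂ) → ℝ, Continuous f →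
        (∀ U, ¬ (∀ (n : ℕ) (hjn : j + 1 ≤ n) (hnK : n ≤ K), PlaqSmall (24 / 25 * θBal F.L γ b₀ p₀ n) (descendTo F ℰp n K hnK U)) → f U = 0) →
        ∀ᵐ V ∂(Measure.map (descendTo F ℰp j K (Nat.le_of_succ_le hjK)) (fieldMeasure (F.P K) 0 ↥(Matrix.specialUnitaryGroup (Fin 2) ℂ))),
          PlaqSmall (θBal F.L γ b₀ p₀ j) V → 0 < c V ∧ ∫ U, f U ∂(σ₀ V) = c V * ∫ U, f U ∂(lam V)) :
    ∃ v : GaugeField (F.P j) 0 ↥(Matrix.specialUnitaryGroup (Fin 2) ℂ) → ℝ,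
      ContinuousOn v {V | PlaqSmall (θBal F.L γ b₀ p₀ j) V} ∧
      (∀ᵐ V ∂(fieldMeasure (F.P j) 0 ↥(Matrix.specialUnitaryGroup (Fin 2) ℂ)), PlaqSmall (θBal F.L γ b₀ p₀ j) V →
        Integrable (fun U => χ U * (Real.log (r U) - Real.log (r' U)) ^ 2 * r' U) (σ V) ∧
        v V = (∫ U, χ U * (Real.log (r U) - Real.log (r' U)) ^ 2 * r' U ∂(σ V)) / (∫ U, χ U * r' U ∂(σ V))) := by
  haveI := hσM
  haveI := hσ₀M
  haveI : BorelSpace (GaugeField (F.P K) 0 ↥(Matrix.specialUnitaryGroup (Fin 2) ℂ)) :=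
    T3OrbitAverage.instBorelSpaceGaugeField
  -- abbreviations
  set θ' : ℝ := θBal F.L γ b₀ p₀ K with hθ'
  set θj : ℝ := θBal F.L γ b₀ p₀ j with hθj
  set Hf : Measure (GaugeField (F.P K) 0 ↥(Matrix.specialUnitaryGroup (Fin 2) ℂ)) :=
    fieldMeasure (F.P K) 0 ↥(Matrix.specialUnitaryGroup (Fin 2) ℂ) with hHf
  set Hc : Measure (GaugeField (F.P j) 0 ↥(Matrix.specialUnitaryGroup (Fin 2) ℂ)) :=
    fieldMeasure (F.P j) 0 ↥(Matrix.specialUnitaryGroup (Fin 2) ℂ) with hHc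
  haveI : IsProbabilityMeasure Hf := Missing.isProbabilityMeasure_fieldMeasure _ _
  haveI : Nonempty (GaugeField (F.P K) 0 ↥(Matrix.specialUnitaryGroup (Fin 2) ℂ)) := ⟨fun _ => 1⟩
  have hd : Measurable (descendTo F ℰp j K (Nat.le_of_succ_le hjK) :
      GaugeField (F.P K) 0 ↥(Matrix.specialUnitaryGroup (Fin 2) ℂ) →
        GaugeField (F.P j) 0 ↥(Matrix.specialUnitaryGroup (Fin 2) ℂ)) :=
    measurable_descendTo F ℰp measurableE_ℰp _
  -- the multi-level window sits inside the `24∕25·θ_K`-window (its level-`K` clause), hence inside the open top window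
  have hMWtop : ∀ U : GaugeField (F.P K) 0 ↥(Matrix.specialUnitaryGroup (Fin 2) ℂ), (∀ (n : ℕ) (hjn : j + 1 ≤ n) (hnK : n ≤ K), PlaqSmall (24 / 25 * θBal F.L γ b₀ p₀ n) (descendTo F ℰp n K hnK U)) →
      PlaqSmall (24 / 25 * θBal F.L γ b₀ p₀ K) U := by
    intro U hU
    have h := hU K hjK le_rfl
    rw [T3DescentFibreTower.descendTo_self] at h
    exact h
  have hcut : 24 / 25 * θBal F.L γ b₀ p₀ K < θBal F.L γ b₀ p₀ K := by nlinarith [hθ]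
  -- the windows
  set O : Set (GaugeField (F.P K) 0 ↥(Matrix.specialUnitaryGroup (Fin 2) ℂ)) := {U | PlaqSmall θ' U} with hO
  set O₃ : Set (GaugeField (F.P K) 0 ↥(Matrix.specialUnitaryGroup (Fin 2) ℂ)) := {U | (∀ (n : ℕ) (hjn : j + 1 ≤ n) (hnK : n ≤ K), PlaqSmall (24 / 25 * θBal F.L γ b₀ p₀ n) (descendTo F ℰp n K hnK U))} with hO₃
  set W : Set (GaugeField (F.P j) 0 ↥(Matrix.specialUnitaryGroup (Fin 2) ℂ)) := {V | PlaqSmall θj V} with hW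
  have hOopen : IsOpen O := isOpen_setOf_plaqSmall_SU 2 (F.P K) 0 θ'
  have hχts : tsupport χ ⊆ O := tsupport_subset_plaqSmall hcut fun U hU => hMWtop U (hχsupp U hU)
  have hO₃O : O₃ ⊆ O := fun U hU p => (hMWtop U hU p).trans hcut
  -- the two localised integrands, globally continuous
  set g : GaugeField (F.P K) 0 ↥(Matrix.specialUnitaryGroup (Fin 2) ℂ) → ℝ :=
    fun U => (Real.log (r U) - Real.log (r' U)) ^ 2 * r' U with hg
  have hgc : ContinuousOn g O :=
    (((hr.log fun U hU => (hpos U hU).1.ne').sub (hr'.log fun U hU => (hpos U hU).2.ne')).pow 2).mul hr'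
  set f₁ : GaugeField (F.P K) 0 ↥(Matrix.specialUnitaryGroup (Fin 2) ℂ) → ℝ := fun U => χ U * g U with hf₁
  set f₂ : GaugeField (F.P K) 0 ↥(Matrix.specialUnitaryGroup (Fin 2) ℂ) → ℝ := fun U => χ U * r' U with hf₂
  have hf₁c : Continuous f₁ := continuous_mul_of_tsupport_subset hOopen hχc hχts hgc
  have hf₂c : Continuous f₂ := continuous_mul_of_tsupport_subset hOopen hχc hχts hr'
  have hf₁eq : (fun U => χ U * (Real.log (r U) - Real.log (r' U)) ^ 2 * r' U) = f₁ := by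
    funext U; simp only [hf₁, hg]; ring
  have hf₁supp : ∀ U, f₁ U ≠ 0 → (∀ (n : ℕ) (hjn : j + 1 ≤ n) (hnK : n ≤ K), PlaqSmall (24 / 25 * θBal F.L γ b₀ p₀ n) (descendTo F ℰp n K hnK U)) :=
    fun U hU => hχsupp U (left_ne_zero_of_mul hU)
  have hf₂supp : ∀ U, f₂ U ≠ 0 → (∀ (n : ℕ) (hjn : j + 1 ≤ n) (hnK : n ≤ K), PlaqSmall (24 / 25 * θBal F.L γ b₀ p₀ n) (descendTo F ℰp n K hnK U)) :=
    fun U hU => hχsupp U (left_ne_zero_of_mul hU)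
  have hf₁zero : ∀ U, U ∉ O₃ → f₁ U = 0 := fun U hU => by
    by_contra h; exact hU (hf₁supp U h)
  have hf₂zero : ∀ U, U ∉ O₃ → f₂ U = 0 := fun U hU => by
    by_contra h; exact hU (hf₂supp U h)
  have hf₂nn : ∀ U, 0 ≤ f₂ U := by
    intro U
    by_cases hU : χ U = 0
    · simp only [hf₂, hU, zero_mul, le_refl]
    · exact mul_nonneg (hχ0 U) (hpos U (hO₃O (hχsupp U hU))).2.le
  have hf₂O₃ : ∀ U, U ∈ O₃ → f₂ U ≠ 0 := fun U hU =>
    mul_ne_zero (hχpos U hU).ne' (hpos U (hO₃O hU)).2.ne'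
  -- the version
  set num : GaugeField (F.P j) 0 ↥(Matrix.specialUnitaryGroup (Fin 2) ℂ) → ℝ := fun V => ∫ U, f₁ U ∂(lam V) with hnum
  set den : GaugeField (F.P j) 0 ↥(Matrix.specialUnitaryGroup (Fin 2) ℂ) → ℝ := fun V => ∫ U, f₂ U ∂(lam V) with hden
  have hnumc : ContinuousOn num W := hA1 f₁ hf₁c hf₁supp
  have hdenc : ContinuousOn den W := hA1 f₂ hf₂c hf₂supp
  have hdenpos : ∀ V, V ∈ W → 0 < den V := by
    intro V hV
    haveI := hlam V
    have hint : Integrable f₂ (lam V) := integrable_of_continuous_compact hf₂c (lam V)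
    rw [hden]
    refine (integral_pos_iff_support_of_nonneg_ae (Eventually.of_forall hf₂nn) hint).mpr ?_
    exact (hA2 V hV).trans_le (measure_mono fun U hU => Function.mem_support.mpr (hf₂O₃ U hU))
  refine ⟨fun V => num V / den V, hnumc.div hdenc fun V hV => (hdenpos V hV).ne', ?_⟩
  -- uniqueness of the disintegration: σ = σ₀ a.e.
  have huniq : ∀ᵐ V ∂(Hf.map (descendTo F ℰp j K (Nat.le_of_succ_le hjK))), σ V = σ₀ V :=
    ae_eq_of_bind_of_bind Hf hd σ σ₀ hbind hfib hbind₀ hfib₀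
  -- the identity, `descendTo_* dU_K`-a.e. on the window
  have hkey : ∀ᵐ V ∂(Hf.map (descendTo F ℰp j K (Nat.le_of_succ_le hjK))), V ∈ W →
      (Integrable (fun U => χ U * (Real.log (r U) - Real.log (r' U)) ^ 2 * r' U) (σ V) ∧
        num V / den V = (∫ U, χ U * (Real.log (r U) - Real.log (r' U)) ^ 2 * r' U ∂(σ V)) / (∫ U, χ U * r' U ∂(σ V))) := by
    obtain ⟨c, hc⟩ := hA3
    filter_upwards [huniq, hc f₁ hf₁c hf₁zero, hc f₂ hf₂c hf₂zero] with V hVσ hV1 hV2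
    intro hVW
    refine ⟨?_, ?_⟩
    · rw [hf₁eq]; exact integrable_of_continuous_compact hf₁c (σ V)
    obtain ⟨hc0, hres1⟩ := hV1 hVW
    obtain ⟨-, hres2⟩ := hV2 hVW
    rw [hf₁eq, show (fun U => χ U * r' U) = f₂ from rfl, hVσ, hres1, hres2, mul_div_mul_left _ _ hc0.ne']
  -- transfer `descend_* dU_{j+1}`-a.e. ⇒ `dU_j`-a.e. on the window through the (≪-form) consistency identity
  have hWne : ∀ V ∈ W, ENNReal.ofReal (rj V) ≠ 0 := fun V hV => (ENNReal.ofReal_pos.mpr (hrjpos V hV)).ne'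
  have hρX : AEMeasurable (fun V => ENNReal.ofReal (rj V)) Hc := (ENNReal.measurable_ofReal.comp hrj).aemeasurable
  have := OrganTangentFibreMeanVersionKnit.ae_on_of_ae_map_of_ac_of_map_eq Hf hd Hc mY hmY hρX hcons hWne hkey
  filter_upwards [this] with V hV hVW
  exact hV hVW hVW


/-! ## §2 From a height: the version along `descendTo`, for every family, depth, weight and disintegration -/

/-! ## §2 From a height -/

/-- ★ **THE SECOND-MOMENT VERSION ALONG `descendTo`, FROM A HEIGHT**: ✓(L17) `exists_height_fibreMeanVersion_descendTo` with the integrand squared := ✓(L16) ∘ §1.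
[cite: Balaban1985Averaging, (10)-(13) p.19; Balaban1985UV3, (7) p.257] -/
theorem exists_height_fibreSecondMomentVersion_descendTo
    (F : T3Family) (γ b₀ p₀ : ℝ) (hγ : 0 < γ) (hγ1 : γ ≤ 1) (hb₀ : 0 < b₀) (hp₀ : 0 < p₀) :
    ∃ jA : ℕ, ∀ (j : ℕ), jA ≤ j → ∀ (K : ℕ) (hjK : j + 1 ≤ K),
      ∀ (r r' : GaugeField (F.P K) 0 ↥(Matrix.specialUnitaryGroup (Fin 2) ℂ) → ℝ) (rj : GaugeField (F.P j) 0 ↥(Matrix.specialUnitaryGroup (Fin 2) ℂ) → ℝ),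
        (∀ U, PlaqSmall (θBal F.L γ b₀ p₀ K) U → 0 < r U ∧ 0 < r' U) →
        ContinuousOn r {U | PlaqSmall (θBal F.L γ b₀ p₀ K) U} → ContinuousOn r' {U | PlaqSmall (θBal F.L γ b₀ p₀ K) U} →
        Measurable rj → (∀ V, PlaqSmall (θBal F.L γ b₀ p₀ j) V → 0 < rj V) →
      ∀ (mY : Measure (GaugeField (F.P K) 0 ↥(Matrix.specialUnitaryGroup (Fin 2) ℂ))), mY ≪ fieldMeasure (F.P K) 0 ↥(Matrix.specialUnitaryGroup (Fin 2) ℂ) →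
        mY.map (descendTo F ℰp j K (Nat.le_of_succ_le hjK)) = (fieldMeasure (F.P j) 0 ↥(Matrix.specialUnitaryGroup (Fin 2) ℂ)).withDensity (fun V => ENNReal.ofReal (rj V)) →
      ∀ (χ : GaugeField (F.P K) 0 ↥(Matrix.specialUnitaryGroup (Fin 2) ℂ) → ℝ), Continuous χ → (∀ U, 0 ≤ χ U) →
        (∀ U, χ U ≠ 0 → (∀ (n : ℕ) (hjn : j + 1 ≤ n) (hnK : n ≤ K), PlaqSmall (24 / 25 * θBal F.L γ b₀ p₀ n) (descendTo F ℰp n K hnK U))) → (∀ U, (∀ (n : ℕ) (hjn : j + 1 ≤ n) (hnK : n ≤ K), PlaqSmall (24 / 25 * θBal F.L γ b₀ p₀ n) (descendTo F ℰp n K hnK U)) → 0 < χ U) →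
      ∀ (σ : Kernel (GaugeField (F.P j) 0 ↥(Matrix.specialUnitaryGroup (Fin 2) ℂ)) (GaugeField (F.P K) 0 ↥(Matrix.specialUnitaryGroup (Fin 2) ℂ))), IsMarkovKernel σ →
        (Measure.map (descendTo F ℰp j K (Nat.le_of_succ_le hjK)) (fieldMeasure (F.P K) 0 ↥(Matrix.specialUnitaryGroup (Fin 2) ℂ))).bind ⇑σ = fieldMeasure (F.P K) 0 ↥(Matrix.specialUnitaryGroup (Fin 2) ℂ) →
        (∀ᵐ V ∂(Measure.map (descendTo F ℰp j K (Nat.le_of_succ_le hjK)) (fieldMeasure (F.P K) 0 ↥(Matrix.specialUnitaryGroup (Fin 2) ℂ))),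
          ∀ᵐ U ∂(σ V), descendTo F ℰp j K (Nat.le_of_succ_le hjK) U = V) →
      ∃ v : GaugeField (F.P j) 0 ↥(Matrix.specialUnitaryGroup (Fin 2) ℂ) → ℝ,
        ContinuousOn v {V | PlaqSmall (θBal F.L γ b₀ p₀ j) V} ∧
        (∀ᵐ V ∂(fieldMeasure (F.P j) 0 ↥(Matrix.specialUnitaryGroup (Fin 2) ℂ)), PlaqSmall (θBal F.L γ b₀ p₀ j) V →
          Integrable (fun U => χ U * (Real.log (r U) - Real.log (r' U)) ^ 2 * r' U) (σ V) ∧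
          v V = (∫ U, χ U * (Real.log (r U) - Real.log (r' U)) ^ 2 * r' U ∂(σ V)) / (∫ U, χ U * r' U ∂(σ V))) := by
  obtain ⟨jA, hjA⟩ := exists_height_regularSmallFieldDisintegration_descendTo F γ b₀ p₀ hγ hγ1 hb₀ hp₀
  refine ⟨jA, fun j hj K hjK r r' rj hpos hr hr' hrj hrjpos mY hmY hcons χ hχc hχ0 hχsupp hχpos σ hσM hbind hfib => ?_⟩
  obtain ⟨σ₀, lam, hσ₀M, hbind₀, hfib₀, hlam, hA1, hA2, hA3⟩ := hjA j hj K hjK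
  have hθ : 0 < θBal F.L γ b₀ p₀ K := T3MinimiserStabilityReduction.θBal_pos F.hL.2.le hγ hγ1 hb₀ p₀ K
  exact fibreSecondMomentVersion_descendTo_of_regularSmallFieldDisintegration_ac F γ b₀ p₀ j K hjK hθ r r' rj hpos hr hr' hrj hrjpos mY hmY hcons
    σ hσM hbind hfib χ hχc hχ0 hχsupp hχpos σ₀ hσ₀M hbind₀ hfib₀ lam hlam hA1 hA2 hA3

/-! ## §3 From the frame's cut clause ⑦ -/

/-- ★★ **THE m-STEP SECOND-MOMENT VERSION FROM THE FRAME'S CLAUSES ALONE**: ✓(L20′) `exists_height_fibreMeanVersionMW_of_towerCut'` with the integrand squared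
(`Measurable (ρ j)` only) := clause ⑦ iterated (✓`towerCut_iterate`) + ✓`exists_height_multiWindowWeight` + §2.
[cite: Balaban1985Averaging, (10)-(13) p.19; Balaban1987RG1, (0.11) p.253 and (0.13) p.254; Balaban1985UV3, (7) p.257] -/
theorem exists_height_fibreSecondMomentVersionMW_of_towerCut'
    (F : T3Family) (γ b₀ p₀ : ℝ) (hγ : 0 < γ) (hγ1 : γ ≤ 1) (hb₀ : 0 < b₀) (hp₀ : 0 < p₀) :
    ∃ jA : ℕ, ∀ (j : ℕ), jA ≤ j → ∀ (K : ℕ) (hjK : j + 1 ≤ K),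
      ∀ (ρ : (n : ℕ) → GaugeField (F.P n) 0 ↥(Matrix.specialUnitaryGroup (Fin 2) ℂ) → ℝ)
        (ρ' : GaugeField (F.P K) 0 ↥(Matrix.specialUnitaryGroup (Fin 2) ℂ) → ℝ),
        Measurable (ρ j) →
        -- clause ⑦ (one-step SF-projection of the unprimed tower) on `[j, K)`
        (∀ n, j ≤ n → n < K →
          (fieldMeasure (F.P n) 0 ↥(Matrix.specialUnitaryGroup (Fin 2) ℂ)).withDensity (fun V => ENNReal.ofReal (ρ n V)) =
            Measure.map (descend F ℰp n)
              (((fieldMeasure (F.P (n + 1)) 0 ↥(Matrix.specialUnitaryGroup (Fin 2) ℂ)).withDensity (fun U => ENNReal.ofReal (ρ (n + 1) U))).withDensity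
                (fun U => ENNReal.ofReal (∏ p : Plaq (F.P (n + 1)) 0,
                  max 0 (min 1 ((24 / 25 * θBal F.L γ b₀ p₀ (n + 1) - dist1 (GaugeField.plaqHol U p)) / ((24 / 25 - 1 / 2) * θBal F.L γ b₀ p₀ (n + 1)))))))) →
        -- the bottom density is positive on the coarse window; the top densities are positive and continuous on the top window
        (∀ V, PlaqSmall (θBal F.L γ b₀ p₀ j) V → 0 < ρ j V) →
        (∀ U, PlaqSmall (θBal F.L γ b₀ p₀ K) U → 0 < ρ K U ∧ 0 < ρ' U) →
        ContinuousOn (ρ K) {U | PlaqSmall (θBal F.L γ b₀ p₀ K) U} → ContinuousOn ρ' {U | PlaqSmall (θBal F.L γ b₀ p₀ K) U} →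
      ∀ (σ : Kernel (GaugeField (F.P j) 0 ↥(Matrix.specialUnitaryGroup (Fin 2) ℂ)) (GaugeField (F.P K) 0 ↥(Matrix.specialUnitaryGroup (Fin 2) ℂ))),
        IsMarkovKernel σ →
        (Measure.map (descendTo F ℰp j K (Nat.le_of_succ_le hjK)) (fieldMeasure (F.P K) 0 ↥(Matrix.specialUnitaryGroup (Fin 2) ℂ))).bind ⇑σ =
          fieldMeasure (F.P K) 0 ↥(Matrix.specialUnitaryGroup (Fin 2) ℂ) →
        (∀ᵐ V ∂(Measure.map (descendTo F ℰp j K (Nat.le_of_succ_le hjK)) (fieldMeasure (F.P K) 0 ↥(Matrix.specialUnitaryGroup (Fin 2) ℂ))),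
          ∀ᵐ U ∂(σ V), descendTo F ℰp j K (Nat.le_of_succ_le hjK) U = V) →
      ∃ v : GaugeField (F.P j) 0 ↥(Matrix.specialUnitaryGroup (Fin 2) ℂ) → ℝ,
        ContinuousOn v {V | PlaqSmall (θBal F.L γ b₀ p₀ j) V} ∧
        (∀ᵐ V ∂(fieldMeasure (F.P j) 0 ↥(Matrix.specialUnitaryGroup (Fin 2) ℂ)), PlaqSmall (θBal F.L γ b₀ p₀ j) V →
          Integrable (fun U => (∏ i ∈ Finset.range (K - j), (if h : j + 1 + i ≤ K then
              (∏ p : Plaq (F.P (j + 1 + i)) 0, max 0 (min 1 ((24 / 25 * θBal F.L γ b₀ p₀ (j + 1 + i) -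
                dist1 (GaugeField.plaqHol (descendTo F ℰp (j + 1 + i) K h U) p)) / ((24 / 25 - 1 / 2) * θBal F.L γ b₀ p₀ (j + 1 + i))))) else 1)) *
            (Real.log (ρ K U) - Real.log (ρ' U)) ^ 2 * ρ' U) (σ V) ∧
          v V = (∫ U, (∏ i ∈ Finset.range (K - j), (if h : j + 1 + i ≤ K then
              (∏ p : Plaq (F.P (j + 1 + i)) 0, max 0 (min 1 ((24 / 25 * θBal F.L γ b₀ p₀ (j + 1 + i) -
                dist1 (GaugeField.plaqHol (descendTo F ℰp (j + 1 + i) K h U) p)) / ((24 / 25 - 1 / 2) * θBal F.L γ b₀ p₀ (j + 1 + i))))) else 1)) *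
            (Real.log (ρ K U) - Real.log (ρ' U)) ^ 2 * ρ' U ∂(σ V)) /
            (∫ U, (∏ i ∈ Finset.range (K - j), (if h : j + 1 + i ≤ K then
              (∏ p : Plaq (F.P (j + 1 + i)) 0, max 0 (min 1 ((24 / 25 * θBal F.L γ b₀ p₀ (j + 1 + i) -
                dist1 (GaugeField.plaqHol (descendTo F ℰp (j + 1 + i) K h U) p)) / ((24 / 25 - 1 / 2) * θBal F.L γ b₀ p₀ (j + 1 + i))))) else 1)) *
            ρ' U ∂(σ V))) := by
  classical
  obtain ⟨j₁, hj₁⟩ := exists_height_fibreSecondMomentVersion_descendTo F γ b₀ p₀ hγ hγ1 hb₀ hp₀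
  obtain ⟨j₂, hj₂⟩ := exists_height_multiWindowWeight F γ b₀ p₀ hγ hγ1 hb₀
  refine ⟨max j₁ j₂, fun j hj K hjK ρ ρ' hρj hcut hρjpos hpos hr hr' σ hσM hbind hfib => ?_⟩
  obtain ⟨hχc, hχ0, hχsupp, hχpos⟩ := hj₂ j (le_of_max_le_right hj) K hjK
  -- the tower of weighted measures and the `ℝ≥0∞` cut-off family
  set μ : (n : ℕ) → Measure (GaugeField (F.P n) 0 ↥(Matrix.specialUnitaryGroup (Fin 2) ℂ)) :=
    fun n => (fieldMeasure (F.P n) 0 ↥(Matrix.specialUnitaryGroup (Fin 2) ℂ)).withDensity (fun V => ENNReal.ofReal (ρ n V)) with hμ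
  set w : (n : ℕ) → GaugeField (F.P n) 0 ↥(Matrix.specialUnitaryGroup (Fin 2) ℂ) → ℝ≥0∞ := fun n U =>
    ENNReal.ofReal (∏ p : Plaq (F.P n) 0, max 0 (min 1 ((24 / 25 * θBal F.L γ b₀ p₀ n - dist1 (GaugeField.plaqHol U p)) / ((24 / 25 - 1 / 2) * θBal F.L γ b₀ p₀ n))))
    with hw
  have hwm : ∀ n, Measurable (w n) := fun n => ENNReal.measurable_ofReal.comp (measurable_sfCutRamp (1 / 2) (24 / 25) _)
  -- clause ⑦ iterated
  have hiter := towerCut_iterate F μ w hwm j K (Nat.le_of_succ_le hjK) (fun n hjn hnK => hcut n hjn hnK)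
  -- the consistency measure and its two letters
  set mY : Measure (GaugeField (F.P K) 0 ↥(Matrix.specialUnitaryGroup (Fin 2) ℂ)) := (μ K).withDensity (fun U =>
    ∏ i ∈ Finset.range (K - j), (if h : j + 1 + i ≤ K then w (j + 1 + i) (descendTo F ℰp (j + 1 + i) K h U) else 1)) with hmY
  have hmYac : mY ≪ fieldMeasure (F.P K) 0 ↥(Matrix.specialUnitaryGroup (Fin 2) ℂ) :=
    (withDensity_absolutelyContinuous _ _).trans (withDensity_absolutelyContinuous _ _)
  have hcons : mY.map (descendTo F ℰp j K (Nat.le_of_succ_le hjK)) =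
      (fieldMeasure (F.P j) 0 ↥(Matrix.specialUnitaryGroup (Fin 2) ℂ)).withDensity (fun V => ENNReal.ofReal (ρ j V)) := hiter.symm
  -- the version
  exact hj₁ j (le_of_max_le_left hj) K hjK (ρ K) ρ' (ρ j) hpos hr hr' hρj hρjpos mY hmYac hcons _ hχc hχ0 hχsupp hχpos σ hσM hbind hfib

end Summit.QuantumFields.YangMills.Theorems.OrganTangentSecondMomentVersionMW

end
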